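import Literature.AnabelianGeometry.EtaleTheta.Discharge.Sec1Thm110iUniqueOfProp15iii
import Literature.AnabelianGeometry.EtaleTheta.ThetaCohomologyAnchored
import HarnessLib

/-!
# [EtTh] Thm. 1.10 (i), uniqueness clause at ANCHORED standard data (K2 row r8″, second file)

S. Mochizuki, *The étale theta function …*, Publ. RIMS 45 (2009), §1, Def. 1.9 p.255, Thm. 1.10 (i)
p.255, Prop. 1.4 (ii)/(iii) p.248 [cite: MochizukiEtTh2009, Thm 1.10 (i) p.29].  PROOF-ONLY companion
(no `def`) of abc-iut-L2-t1's `ThetaCohomologyAnchored.lean` (p421374: `AnchoredPoint`,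
`AnchoredStandardData` — the repair of F-0590) and of `Discharge/Sec1Thm110iUniqueOfProp15iii.lean`
(p422175, this seat).  Cell sub-DAG plan/L2/SUBDAG-EtTh-Thm110.md, holder abc-iut-w5-d140.

* `MuTwoSetting.thm110iUnique_anchored_of_prop15iii` — at ANCHORED standard data the two anchor
  equations of `thm110iUnique_of_prop15iii` are the fields `AnchoredPoint.evalAt_logUdd` of `τ`, `τ⁻¹`;
  residual hypotheses: the FACTS `Prop15ii`, `Prop15iii` and the one sign relation
  `value_{τ⁻¹}(η̈) = ± value_τ(η̈)`;
* `MuTwoSetting.exists_sign_relation_of_valueLaw_pair` — that sign relation, WITH THE PRINTED SIGN `−1`,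
  from the reference-class value law at the TWO points `τ`, `τ⁻¹` only (one constant `c`:
  `value_y(η̈) = c·Θ̈(Ü(y))`, the two-point instance of `EtaleThetaData.exists_val_families_of_lawOn` /
  GAP row G-L2t6g4-2) and `Θ̈(Ü⁻¹) = −Θ̈(Ü)` (abc-iut-L2-t1's `thetaDdot_inv`, Prop. 1.4 (ii), PROVED);
* `MuTwoSetting.thm110iUnique_anchored_of_valueLaw_pair` — hence `Thm110iUnique` at anchored standard
  data from {`Prop15ii`, `Prop15iii`, the value law of `η̈` at the two points}.
HONEST FRAMING: typed ≠ proved for [EtTh]; facts BY NAME, the two-point value law an explicit binder;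
nothing here bears on the disputed [IUTchIII] Cor. 3.12.
-/

noncomputable section

namespace Literature.AnabelianGeometry.EtaleTheta

open Literature.AnabelianGeometry.SemiGraphs

namespace MuTwoSetting

variable {p : ℕ} [Fact p.Prime] {M : MuTwoSetting p}

/-- **Thm. 1.10 (i) «up to ±1» at ANCHORED standard data** (Def. 1.9 with `τ`, `τ⁻¹` anchored points,
abc-iut-L2-t1's repair of F-0590): from the FACTS Prop. 1.5 (ii), (iii) and the sign relation between
the values of `η̈` at `τ⁻¹` and `τ`. [cite: MochizukiEtTh2009, Thm 1.10 (i) p.29] -/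
theorem thm110iUnique_anchored_of_prop15iii (hC : M.toThetaSetting.Compat) {εZ : M.GtpC}
    (hZ : M.IsAdmissibleEpsZ εZ) (E : M.toThetaSetting.EtaleThetaData)
    (A : M.AnchoredStandardData E.toKummerData)
    (h15ii : ThetaSetting.Prop15ii E.toKummerData hC) (h15iii : ThetaSetting.Prop15iii E hC)
    (hsym : ∃ w : (↥M.Kdd)ˣ, (((w : M.Kdd) : PadicAlgCl p) = 1 ∨ ((w : M.Kdd) : PadicAlgCl p) = -1) ∧
      A.tauInv.evalAt (ContH1.res M.toTheta M.toThetaSetting.DeltaTheta A.tauInv.Dpt_le E.etaDd) =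
        E.toKddHat w *
          A.tau.evalAt (ContH1.res M.toTheta M.toThetaSetting.DeltaTheta A.tau.Dpt_le E.etaDd)) :
    Thm110iUnique hC hZ E A.toStandardData :=
  thm110iUnique_of_prop15iii hC hZ E A.toStandardData h15ii h15iii A.tau.evalAt_logUdd
    A.tauInv.evalAt_logUdd hsym

/-- **The sign relation from the two-point value law**: if ONE constant `c` gives the values of `η̈` at
both `τ` and `τ⁻¹` as `c · Θ̈(Ü(·))` (the reference-class law on the two points of Def. 1.9), then
`value_{τ⁻¹}(η̈) = (−1) · value_τ(η̈)` — since `Ü(τ⁻¹) = Ü(τ)⁻¹` and `Θ̈(Ü⁻¹) = −Θ̈(Ü)` (Prop. 1.4 (ii)).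
[cite: MochizukiEtTh2009, Prop 1.4 (ii) p.22] -/
theorem exists_sign_relation_of_valueLaw_pair {E : M.toThetaSetting.EtaleThetaData}
    (S : M.StandardData E.toKummerData) {c : PadicAlgCl p} {v₁ v₂ : (↥M.Kdd)ˣ}
    (hv₁ : ((v₁ : M.Kdd) : PadicAlgCl p) =
      c * thetaDdot M.toThetaSetting.qdd (((S.tau.coord : M.Kdd) : PadicAlgCl p)))
    (hv₂ : ((v₂ : M.Kdd) : PadicAlgCl p) =
      c * thetaDdot M.toThetaSetting.qdd (((S.tauInv.coord : M.Kdd) : PadicAlgCl p)))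
    (he₁ : S.tau.evalAt (ContH1.res M.toTheta M.toThetaSetting.DeltaTheta S.tau.Dpt_le E.etaDd) =
      E.toKddHat v₁)
    (he₂ : S.tauInv.evalAt (ContH1.res M.toTheta M.toThetaSetting.DeltaTheta S.tauInv.Dpt_le
      E.etaDd) = E.toKddHat v₂) :
    ∃ w : (↥M.Kdd)ˣ, (((w : M.Kdd) : PadicAlgCl p) = 1 ∨ ((w : M.Kdd) : PadicAlgCl p) = -1) ∧
      S.tauInv.evalAt (ContH1.res M.toTheta M.toThetaSetting.DeltaTheta S.tauInv.Dpt_le E.etaDd) =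
        E.toKddHat w *
          S.tau.evalAt (ContH1.res M.toTheta M.toThetaSetting.DeltaTheta S.tau.Dpt_le E.etaDd) := by
  refine ⟨v₂ * v₁⁻¹, Or.inr ?_, by rw [he₁, he₂, ← map_mul, inv_mul_cancel_right]⟩
  have hneg : ((v₂ : M.Kdd) : PadicAlgCl p) = -((v₁ : M.Kdd) : PadicAlgCl p) := by
    rw [hv₂, hv₁, S.tauInv_coord, S.tau_coord, thetaDdot_inv, mul_neg]
  rw [coe_units_mul, coe_units_inv', hneg, neg_mul, mul_inv_cancel₀ (coe_units_ne_zero v₁)]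

/-- **Thm. 1.10 (i) «up to ±1» at anchored standard data from the two FACTS and the TWO-POINT value
law of `η̈`** (`value_y(η̈) = c·Θ̈(Ü(y))` for `y ∈ {τ, τ⁻¹}` with one constant `c` — the instance at the two
points of Def. 1.9 of the reference-class law, GAP row G-L2t6g4-2). [cite: MochizukiEtTh2009, Thm 1.10 (i) p.29] -/
theorem thm110iUnique_anchored_of_valueLaw_pair (hC : M.toThetaSetting.Compat) {εZ : M.GtpC}
    (hZ : M.IsAdmissibleEpsZ εZ) (E : M.toThetaSetting.EtaleThetaData)
    (A : M.AnchoredStandardData E.toKummerData)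
    (h15ii : ThetaSetting.Prop15ii E.toKummerData hC) (h15iii : ThetaSetting.Prop15iii E hC)
    {c : PadicAlgCl p} {v₁ v₂ : (↥M.Kdd)ˣ}
    (hv₁ : ((v₁ : M.Kdd) : PadicAlgCl p) =
      c * thetaDdot M.toThetaSetting.qdd (((A.tau.coord : M.Kdd) : PadicAlgCl p)))
    (hv₂ : ((v₂ : M.Kdd) : PadicAlgCl p) =
      c * thetaDdot M.toThetaSetting.qdd (((A.tauInv.coord : M.Kdd) : PadicAlgCl p)))
    (he₁ : A.tau.evalAt (ContH1.res M.toTheta M.toThetaSetting.DeltaTheta A.tau.Dpt_le E.etaDd) =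
      E.toKddHat v₁)
    (he₂ : A.tauInv.evalAt (ContH1.res M.toTheta M.toThetaSetting.DeltaTheta A.tauInv.Dpt_le
      E.etaDd) = E.toKddHat v₂) :
    Thm110iUnique hC hZ E A.toStandardData :=
  thm110iUnique_anchored_of_prop15iii hC hZ E A h15ii h15iii
    (exists_sign_relation_of_valueLaw_pair A.toStandardData hv₁ hv₂ he₁ he₂)

end MuTwoSetting

end Literature.AnabelianGeometry.EtaleTheta

end
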